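import Summits.Ventures.Crystal3D.Theorems.StickyWulffConstantGenericWallFloorSigma9FullDown
import Summits.Ventures.Crystal3D.Theorems.StickyWulffConstantGenericWallFloorSigma9Full
import Summits.Ventures.Crystal3D.Theorems.StickyWulffConstantGenericWallFloorStackLedgerCrossWide
import Summits.Ventures.Crystal3D.Theorems.StickyWulffConstantGenericWallFloorSigma9Tilt
import HarnessLib

/-!
# The one-sided `Σ9` classes with WIDE tilted verticals (`‖z₁ − e₃‖, ‖z₂ + e₃‖ ≤ 1/3`)
# (crux `GenericWallFloor`, stmt-Ventures-19480, line `WallLedgerG`)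

HONEST FRAMING. Venture `Summits/Ventures/Crystal3D` (cell `crystal3d-full`), helper `--supports` the crux `GenericWallFloor`,
REGISTERED line `WallLedgerG`, open stub `stub_twoSlabAdhesion`.  Rung credit only; F-C1 not moved; NOT the crux (inputs
`ExactOnly`(C12-55), `StarPairFar`, `InPlaneTwinStarPair` BY NAME; charge `½(κ₁+κ₂)`).  `…Sigma9Tilt` VERBATIM with the tilt
`1/4 ↦ 1/3` via `twoSlabAdhesion_stackLedger_cross_wide`: `genericWallFloorAtCharge_sigma9{,Down}_wide_of_far`.  Census
(`calc/tilt_coverage_wide.py`): with slots of `e₃`-component `≥ 9/20` the priced class applies to `99.6 %` of `Σ9` orientations and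
reaches charge `≥ 1` on `≈ 97.7 %` (`1/4`-tilt: `94.5 %`; `e₃`: `83 %`).  NOT the residual; F-C1 not moved.
-/

noncomputable section

namespace Summit.Ventures.Crystal3D.Theorems

open Summit.Ventures.Crystal3D Finset
open Literature.MathematicalPhysics.StatisticalMechanics (fccStacking barlowStacking IsHaggSeq contactDeficiency)
open scoped InnerProductSpace

open scoped Classical in
/-- **The lower one-sided `Σ9` class with tilted verticals**: grain 1's slot `u₁` IN the first mirror plane, steep for
`z₁` (`‖z₁ − e₃‖ ≤ 1/4`); grain 2's slot steep for `z₂` (`‖z₂ + e₃‖ ≤ 1/4`) with the level-two condition read for the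
vertical `z₂`.  Conclusion `GenericWallFloorAtCharge (½(κ₁+κ₂))`, modulo `ExactOnly`(C12-55), `StarPairFar`,
`InPlaneTwinStarPair`. -/
theorem genericWallFloorAtCharge_sigma9_wide_of_far
    {s₀ : EuclideanSpace ℝ (Fin 3)} (hs₀ : s₀ ∈ fccSlots)
    (hcert : ExactOnly 0 (fccSlots.filter fun w => 0 < ⟪w, s₀⟫_ℝ)) (hfar : StarPairFar) (htw : InPlaneTwinStarPair)
    (A₁ : EuclideanSpace ℝ (Fin 3) ≃ₗᵢ[ℝ] EuclideanSpace ℝ (Fin 3)) (t₁ : EuclideanSpace ℝ (Fin 3))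
    (A₂ : EuclideanSpace ℝ (Fin 3) ≃ₗᵢ[ℝ] EuclideanSpace ℝ (Fin 3)) (t₂ : EuclideanSpace ℝ (Fin 3))
    {z₁ : EuclideanSpace ℝ (Fin 3)} (hz₁ : ‖z₁‖ = 1) (hze₁ : ‖z₁ - EuclideanSpace.single (2 : Fin 3) (1 : ℝ)‖ ≤ 1 / 3)
    {z₂ : EuclideanSpace ℝ (Fin 3)} (hz₂ : ‖z₂‖ = 1) (hze₂ : ‖z₂ + EuclideanSpace.single (2 : Fin 3) (1 : ℝ)‖ ≤ 1 / 3)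
    {u₁ : EuclideanSpace ℝ (Fin 3)} (hu₁ : u₁ ∈ fccSlots) (hsteep₁ : Real.sqrt 2 / 2 ≤ ⟪A₁ u₁, z₁⟫_ℝ)
    {u₂ : EuclideanSpace ℝ (Fin 3)} (hu₂ : u₂ ∈ fccSlots) (hsteep₂ : Real.sqrt 2 / 2 ≤ ⟪A₂ u₂, z₂⟫_ℝ)
    (μk μk1 : EuclideanSpace ℝ (Fin 3))
    (hκl : ∀ μ ∈ [μk, μk1], ‖μ‖ = 1 ∧
      ∀ w ∈ fccSlots, ⟪w, μ⟫_ℝ = 0 ∨ ⟪w, μ⟫_ℝ = Real.sqrt (2 / 3) ∨ ⟪w, μ⟫_ℝ = -Real.sqrt (2 / 3))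
    (hκc : List.IsChain (fun μ μ' => ⟪μ, μ'⟫_ℝ = 1 / 3 ∨ ⟪μ, μ'⟫_ℝ = -1 / 3) [μk, μk1])
    (hA₂ : A₂ '' fccStacking 1 (Real.sqrt (2 / 3)) = (wordFrame A₁ [μk, μk1]) '' fccStacking 1 (Real.sqrt (2 / 3)))
    (hfirst : ⟪u₁, μk1⟫_ℝ = 0)
    (hsecond : ∀ n₁ : EuclideanSpace ℝ (Fin 3),
      (n₁ = wordFrame A₁ [μk, μk1] μk ∨ n₁ = -wordFrame A₁ [μk, μk1] μk) → ⟪A₂ u₂, n₁⟫_ℝ = Real.sqrt (2 / 3) →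
      ∀ q ∈ fccSlots, 0 < ⟪twinFrame A₂ n₁ q, n₁⟫_ℝ →
        (∀ q' ∈ fccSlots, 0 < ⟪twinFrame A₂ n₁ q', n₁⟫_ℝ → ⟪twinFrame A₂ n₁ q', z₂⟫_ℝ ≤ ⟪twinFrame A₂ n₁ q, z₂⟫_ℝ) →
        (wordFrame A₁ [μk, μk1]).symm (A₂ ((twinFrame A₂ n₁).symm ((2 * Real.sqrt (2 / 3)) • twinFrame A₂ n₁ q - n₁))) ≠ μk1 ∧
        (wordFrame A₁ [μk, μk1]).symm (A₂ ((twinFrame A₂ n₁).symm ((2 * Real.sqrt (2 / 3)) • twinFrame A₂ n₁ q - n₁))) ≠ -μk1)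
    (hcap : ∀ n₁ : EuclideanSpace ℝ (Fin 3),
      (n₁ = wordFrame A₁ [μk, μk1] μk ∨ n₁ = -wordFrame A₁ [μk, μk1] μk) → ⟪A₂ u₂, n₁⟫_ℝ = Real.sqrt (2 / 3) →
      ∀ q ∈ fccSlots, 0 < ⟪twinFrame A₂ n₁ q, n₁⟫_ℝ →
        (∀ q' ∈ fccSlots, 0 < ⟪twinFrame A₂ n₁ q', n₁⟫_ℝ → ⟪twinFrame A₂ n₁ q', z₂⟫_ℝ ≤ ⟪twinFrame A₂ n₁ q, z₂⟫_ℝ) →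
        ⟪twinFrame A₂ n₁ q, A₁ μk1⟫_ℝ = 0) :
    GenericWallFloorAtCharge ((Real.sqrt 2 * |⟪A₁ u₁, EuclideanSpace.single (2 : Fin 3) (1 : ℝ)⟫_ℝ| +
        Real.sqrt 2 * |⟪A₂ u₂, EuclideanSpace.single (2 : Fin 3) (1 : ℝ)⟫_ℝ|) / 2) A₁ t₁ A₂ t₂ := by
  set e₃ : EuclideanSpace ℝ (Fin 3) := EuclideanSpace.single (2 : Fin 3) (1 : ℝ) with he₃
  have hκ2 : 2 ≤ [μk, μk1].length := by simp
  have hfirst' : ∀ μ, [μk, μk1].getLast? = some μ → ⟪u₁, μ⟫_ℝ = 0 := fun μ hμ => by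
    simp at hμ; rw [← hμ]; exact hfirst
  -- the trivial grain-1 stack
  have hS₀ : StackSound z₁ [⟨A₁, u₁, 0⟩] := ⟨hu₁, hsteep₁⟩
  have hW₀ : StackWF z₁ [⟨A₁, u₁, 0⟩] := stackWF_start z₁ A₁ u₁
  -- (a) no grain-1 stack frame is `A₂·Λ₀`
  have hfar₁ : ∀ stk : List WalkEntry, StackSound z₁ stk → StackWF z₁ stk → stk.getLast? = some ⟨A₁, u₁, 0⟩ →
      ∀ e ∈ stk, e.frame '' fccStacking 1 (Real.sqrt (2 / 3)) ≠ A₂ '' fccStacking 1 (Real.sqrt (2 / 3)) :=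
    fun stk hS hW hl e he => image_ne_of_word [μk, μk1] hκl hκc hκ2 hA₂ hfirst' hS hW hl he
  -- (b) no grain-2 stack frame is `A₁·Λ₀`
  have hfar₂ : ∀ stk : List WalkEntry, StackSound z₂ stk → StackWF z₂ stk → stk.getLast? = some ⟨A₂, u₂, 0⟩ →
      ∀ e ∈ stk, e.frame '' fccStacking 1 (Real.sqrt (2 / 3)) ≠ A₁ '' fccStacking 1 (Real.sqrt (2 / 3)) := by
    intro stk hS hW hl e he hEq
    obtain ⟨r, hS', hW', hl'⟩ := exists_suffix_of_mem stk e he hS hW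
    rw [hl] at hl'
    have hco := coaxial_linear_of_image_eq (F₁ := (⟨A₁, u₁, 0⟩ : WalkEntry).frame) (F₂ := e.frame) hEq.symm
    obtain ⟨hν, hmenu, himg, -, -⟩ := inPlaneTwin_of_coaxial_sigma9 μk μk1 hκl hκc hA₂ hfirst hsecond hcap
      hS₀ hW₀ rfl hS' hW' hl' hco
    exact image_twinFrame_ne A₁ hν hmenu (himg.symm.trans hEq)
  -- (c) the priced cross pairs
  have hledger := twoSlabAdhesion_stackLedger_cross_wide hs₀ hcert (doubleStarCoaxialAt_of_starPairFar hfar)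
    (capPairCoaxial_of_starPairFar hfar) A₁ t₁ A₂ t₂ hz₁ hze₁ hz₂ hze₂ hu₁ hsteep₁ hu₂ hsteep₂ hfar₁ hfar₂
    (fun stk₁ stk₂ e₁ e₂ rest₁ rest₂ hS₁ hW₁ hl₁ hst₁ hS₂ hW₂ hl₂ hst₂ => by
      by_cases hco : ∃ (L : EuclideanSpace ℝ (Fin 3) ≃ₗᵢ[ℝ] EuclideanSpace ℝ (Fin 3))
          (s₁ s₂ : EuclideanSpace ℝ (Fin 3)) (σ σ' : ℤ → ℤ), IsHaggSeq σ ∧ IsHaggSeq σ' ∧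
          e₁.frame '' fccStacking 1 (Real.sqrt (2 / 3)) ⊆ (fun p => L p + s₁) '' barlowStacking 1 (Real.sqrt (2 / 3)) σ ∧
          e₂.frame '' fccStacking 1 (Real.sqrt (2 / 3)) ⊆ (fun p => L p + s₂) '' barlowStacking 1 (Real.sqrt (2 / 3)) σ'
      · right
        subst hst₁; subst hst₂
        obtain ⟨hν, hmenu, himg, hd₁, hd₂⟩ := inPlaneTwin_of_coaxial_sigma9 μk μk1 hκl hκc hA₂ hfirst hsecond hcap
          hS₁ hW₁ hl₁ hS₂ hW₂ hl₂ hco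
        intro Y hY y hy hown₁ hown₂
        exact ⟨starSet_ne_of_inPlaneTwin hν hmenu himg hS₁.top.1 hd₁,
          cover_of_inPlaneTwinStarPair htw hY hν hmenu himg hS₁.top.1 hS₂.top.1 hd₁ hd₂ hy hown₁ hown₂⟩
      · exact Or.inl hco)
  exact genericWallFloorAtCharge_of_ledger _ A₁ t₁ A₂ t₂ hledger

open scoped Classical in
/-- **The upper one-sided `Σ9` class with tilted verticals** (mirror image: grain 2 carries the word, grain 1 the
level-two condition read for `z₁`).  Conclusion `GenericWallFloorAtCharge (½(κ₁+κ₂))`. -/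
theorem genericWallFloorAtCharge_sigma9Down_wide_of_far
    {s₀ : EuclideanSpace ℝ (Fin 3)} (hs₀ : s₀ ∈ fccSlots)
    (hcert : ExactOnly 0 (fccSlots.filter fun w => 0 < ⟪w, s₀⟫_ℝ)) (hfar : StarPairFar) (htw : InPlaneTwinStarPair)
    (A₁ : EuclideanSpace ℝ (Fin 3) ≃ₗᵢ[ℝ] EuclideanSpace ℝ (Fin 3)) (t₁ : EuclideanSpace ℝ (Fin 3))
    (A₂ : EuclideanSpace ℝ (Fin 3) ≃ₗᵢ[ℝ] EuclideanSpace ℝ (Fin 3)) (t₂ : EuclideanSpace ℝ (Fin 3))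
    {z₁ : EuclideanSpace ℝ (Fin 3)} (hz₁ : ‖z₁‖ = 1) (hze₁ : ‖z₁ - EuclideanSpace.single (2 : Fin 3) (1 : ℝ)‖ ≤ 1 / 3)
    {z₂ : EuclideanSpace ℝ (Fin 3)} (hz₂ : ‖z₂‖ = 1) (hze₂ : ‖z₂ + EuclideanSpace.single (2 : Fin 3) (1 : ℝ)‖ ≤ 1 / 3)
    {u₁ : EuclideanSpace ℝ (Fin 3)} (hu₁ : u₁ ∈ fccSlots) (hsteep₁ : Real.sqrt 2 / 2 ≤ ⟪A₁ u₁, z₁⟫_ℝ)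
    {u₂ : EuclideanSpace ℝ (Fin 3)} (hu₂ : u₂ ∈ fccSlots) (hsteep₂ : Real.sqrt 2 / 2 ≤ ⟪A₂ u₂, z₂⟫_ℝ)
    (μk μk1 : EuclideanSpace ℝ (Fin 3))
    (hκl : ∀ μ ∈ [μk, μk1], ‖μ‖ = 1 ∧
      ∀ w ∈ fccSlots, ⟪w, μ⟫_ℝ = 0 ∨ ⟪w, μ⟫_ℝ = Real.sqrt (2 / 3) ∨ ⟪w, μ⟫_ℝ = -Real.sqrt (2 / 3))
    (hκc : List.IsChain (fun μ μ' => ⟪μ, μ'⟫_ℝ = 1 / 3 ∨ ⟪μ, μ'⟫_ℝ = -1 / 3) [μk, μk1])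
    (hA₁ : A₁ '' fccStacking 1 (Real.sqrt (2 / 3)) = (wordFrame A₂ [μk, μk1]) '' fccStacking 1 (Real.sqrt (2 / 3)))
    (hfirst : ⟪u₂, μk1⟫_ℝ = 0)
    (hsecond : ∀ n₁ : EuclideanSpace ℝ (Fin 3),
      (n₁ = wordFrame A₂ [μk, μk1] μk ∨ n₁ = -wordFrame A₂ [μk, μk1] μk) → ⟪A₁ u₁, n₁⟫_ℝ = Real.sqrt (2 / 3) →
      ∀ q ∈ fccSlots, 0 < ⟪twinFrame A₁ n₁ q, n₁⟫_ℝ →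
        (∀ q' ∈ fccSlots, 0 < ⟪twinFrame A₁ n₁ q', n₁⟫_ℝ → ⟪twinFrame A₁ n₁ q', z₁⟫_ℝ ≤ ⟪twinFrame A₁ n₁ q, z₁⟫_ℝ) →
        (wordFrame A₂ [μk, μk1]).symm (A₁ ((twinFrame A₁ n₁).symm ((2 * Real.sqrt (2 / 3)) • twinFrame A₁ n₁ q - n₁))) ≠ μk1 ∧
        (wordFrame A₂ [μk, μk1]).symm (A₁ ((twinFrame A₁ n₁).symm ((2 * Real.sqrt (2 / 3)) • twinFrame A₁ n₁ q - n₁))) ≠ -μk1)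
    (hcap : ∀ n₁ : EuclideanSpace ℝ (Fin 3),
      (n₁ = wordFrame A₂ [μk, μk1] μk ∨ n₁ = -wordFrame A₂ [μk, μk1] μk) → ⟪A₁ u₁, n₁⟫_ℝ = Real.sqrt (2 / 3) →
      ∀ q ∈ fccSlots, 0 < ⟪twinFrame A₁ n₁ q, n₁⟫_ℝ →
        (∀ q' ∈ fccSlots, 0 < ⟪twinFrame A₁ n₁ q', n₁⟫_ℝ → ⟪twinFrame A₁ n₁ q', z₁⟫_ℝ ≤ ⟪twinFrame A₁ n₁ q, z₁⟫_ℝ) →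
        ⟪twinFrame A₁ n₁ q, A₂ μk1⟫_ℝ = 0) :
    GenericWallFloorAtCharge ((Real.sqrt 2 * |⟪A₁ u₁, EuclideanSpace.single (2 : Fin 3) (1 : ℝ)⟫_ℝ| +
        Real.sqrt 2 * |⟪A₂ u₂, EuclideanSpace.single (2 : Fin 3) (1 : ℝ)⟫_ℝ|) / 2) A₁ t₁ A₂ t₂ := by
  set e₃ : EuclideanSpace ℝ (Fin 3) := EuclideanSpace.single (2 : Fin 3) (1 : ℝ) with he₃
  have hκ2 : 2 ≤ [μk, μk1].length := by simp
  have hfirst' : ∀ μ, [μk, μk1].getLast? = some μ → ⟪u₂, μ⟫_ℝ = 0 := fun μ hμ => by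
    simp at hμ; rw [← hμ]; exact hfirst
  have hS₀ : StackSound z₂ [⟨A₂, u₂, 0⟩] := ⟨hu₂, hsteep₂⟩
  have hW₀ : StackWF z₂ [⟨A₂, u₂, 0⟩] := stackWF_start z₂ A₂ u₂
  have hfar₂ : ∀ stk : List WalkEntry, StackSound z₂ stk → StackWF z₂ stk → stk.getLast? = some ⟨A₂, u₂, 0⟩ →
      ∀ e ∈ stk, e.frame '' fccStacking 1 (Real.sqrt (2 / 3)) ≠ A₁ '' fccStacking 1 (Real.sqrt (2 / 3)) :=
    fun stk hS hW hl e he => image_ne_of_word [μk, μk1] hκl hκc hκ2 hA₁ hfirst' hS hW hl he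
  have hfar₁ : ∀ stk : List WalkEntry, StackSound z₁ stk → StackWF z₁ stk → stk.getLast? = some ⟨A₁, u₁, 0⟩ →
      ∀ e ∈ stk, e.frame '' fccStacking 1 (Real.sqrt (2 / 3)) ≠ A₂ '' fccStacking 1 (Real.sqrt (2 / 3)) := by
    intro stk hS hW hl e he hEq
    obtain ⟨r, hS', hW', hl'⟩ := exists_suffix_of_mem stk e he hS hW
    rw [hl] at hl'
    have hco := coaxial_linear_of_image_eq (F₁ := (⟨A₂, u₂, 0⟩ : WalkEntry).frame) (F₂ := e.frame) hEq.symm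
    obtain ⟨hν, hmenu, himg, -, -⟩ := inPlaneTwin_of_coaxial_sigma9 (A₁ := A₂) (A₂ := A₁) μk μk1 hκl hκc hA₁ hfirst
      hsecond hcap hS₀ hW₀ rfl hS' hW' hl' hco
    exact image_twinFrame_ne A₂ hν hmenu (himg.symm.trans hEq)
  have hledger := twoSlabAdhesion_stackLedger_cross_wide hs₀ hcert (doubleStarCoaxialAt_of_starPairFar hfar)
    (capPairCoaxial_of_starPairFar hfar) A₁ t₁ A₂ t₂ hz₁ hze₁ hz₂ hze₂ hu₁ hsteep₁ hu₂ hsteep₂ hfar₁ hfar₂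
    (fun stk₁ stk₂ e₁ e₂ rest₁ rest₂ hS₁ hW₁ hl₁ hst₁ hS₂ hW₂ hl₂ hst₂ => by
      by_cases hco : ∃ (L : EuclideanSpace ℝ (Fin 3) ≃ₗᵢ[ℝ] EuclideanSpace ℝ (Fin 3))
          (s₁ s₂ : EuclideanSpace ℝ (Fin 3)) (σ σ' : ℤ → ℤ), IsHaggSeq σ ∧ IsHaggSeq σ' ∧
          e₁.frame '' fccStacking 1 (Real.sqrt (2 / 3)) ⊆ (fun p => L p + s₁) '' barlowStacking 1 (Real.sqrt (2 / 3)) σ ∧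
          e₂.frame '' fccStacking 1 (Real.sqrt (2 / 3)) ⊆ (fun p => L p + s₂) '' barlowStacking 1 (Real.sqrt (2 / 3)) σ'
      · right
        subst hst₁; subst hst₂
        obtain ⟨hν, hmenu, himg, hd₂, hd₁⟩ := inPlaneTwin_of_coaxial_sigma9 (A₁ := A₂) (A₂ := A₁) μk μk1 hκl hκc hA₁
          hfirst hsecond hcap hS₂ hW₂ hl₂ hS₁ hW₁ hl₁ (coaxial_linear_symm hco)
        intro Y hY y hy hown₁ hown₂
        refine ⟨(starSet_ne_of_inPlaneTwin hν hmenu himg hS₂.top.1 hd₂ (v₂ := e₁.dir) (e := y)).symm, fun q hq hqd => ?_⟩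
        rw [Finset.union_comm]
        exact cover_of_inPlaneTwinStarPair htw hY hν hmenu himg hS₂.top.1 hS₁.top.1 hd₂ hd₁ hy hown₂ hown₁ q hq hqd
      · exact Or.inl hco)
  exact genericWallFloorAtCharge_of_ledger _ A₁ t₁ A₂ t₂ hledger

end Summit.Ventures.Crystal3D.Theorems

end
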